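import Summits.ResolutionOfSingularities.ResolutionOfSingularities.Theorems.CrossCutCells
import HarnessLib

/-!
# CrossCutCells2 — decomp-res node «CrossCut» (lens-2 g20), file 2/2 of `CrossCutCells`

Content VERBATIM from the decomp-res lens-2 g20 node `HOME/decomp-res-lens-2/g20/CrossCut.lean` (pin 9ac8d1ca, 4 409
l; HOME = run/shared/lean/pub/decomp-res);
CRITIC-LEDGER row 160 (+1); landing orders INBOX :600 (and lens INBOX :582): l. 112–3564 are `SpreadCut` b2959d31
VERBATIM (landed as `SpreadCutLaw…` · `SpreadCutCells` ·
`MaxContactCutSpreadCut`) and are DELETED here with the landed modules imported instead (namespaces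
`…Theorems.PinchCut` / `JetCut` / `PurityCut` / `SplitCut` / `CylinderCut` /
`SpreadCut` opened; same short names, byte-identical bodies — never two copies); NEW = §X (l. 3566–4407).  Namespace
`…Theorems.CrossCut` (the lens's `Theses.CrossCut` is
gate-reserved), sub-namespaces `Cross` / `Leaf` as in the lens (inside the re-entered `namespace Leaf` of §X.3 the
landed `…Theorems.PurityCut.Leaf` is opened so the g16
schema's short names resolve exactly as in the lens); file split only (tree files ≤ 400 lines): sections, variables,
the `open MvPolynomial` lines and every declaration exactly as in
the lens; the node's global dupNamespace-linter line dropped.  Node files, in import order: `CrossCutLaw` (§X.0 ring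
level; continued `…2`) · `CrossCutCells` (§X.2–§X.7
cone-free: the aside / port home; continued `…2`) · the wiring `MaxContactCutCrossCut` (§X BY NAME on the host
route, in the Theses cone).  All `--supports
stmt-ResolutionOfSingularities-29273` (`MaxContactCut.RungOne`); nothing closes 29273 — decided halves carry their
engines / ports as hypotheses (`CrossExit` is a paper engine);
exactly ONE located-residual aside on the lens-2 column (`Cross.CrossSpecialRung`) SUPERSEDES g19's
`Spread.SpreadSpecialRung`, re-located EXACTLY modulo the cross decided half,
and `ComponentPackagePort` is the column's ONE port item.

§X.2–§X.7 cone-free part: §X.2 point / curve level — `IsCrossAt` / `IsFlankAt` / `IsUniformCross`, the ENGINE `def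
CrossExit : Prop` (a paper engine: hypothesis), `IsCrossPt`, the decided class; §X.3 THE COMPONENT PORT —
`IsTopComponent` / `IsComponentExitPt` / **`ComponentPackagePort`** (PORT tag: the lens-2 column's ONE port item;
`curvePackagePort_of_componentPackagePort` derives the older `CurvePackagePort`) and the `Leaf` schema over the
port; §X.4 the leaf `crossLeaf = spreadLeaf ∨ (X)` and the located residual class `IsCrossSpecialPt`; §X.5–§X.7
`namespace Cross`: graded statements, the rungs **`CrossGenericRung`** (DECIDED half modulo ports) /
**`CrossSpecialRung`** (THE LOCATED RESIDUAL — the ONE aside on the lens-2 column, SUPERSEDING g19's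
`Spread.SpreadSpecialRung`), iffs and hypothesis-free links — this module chain is the cone-free aside/port home
(continued `…2` where the cap cuts).  The cut BY NAME on the route is in `MaxContactCutCrossCut`.

Part 2/2 carries: `isSpecPt_crossLeaf_iff`, `isSpreadSpecialPt_of_isCrossSpecialPt`,
`isCylSpecialPt_of_isCrossSpecialPt`, `isSpreadSpecialPt_iff`, `isCrossSpecialPt_iff_of_ne_two`, `SeqXGen`,
`SeqXSpec`, `XGenRungAt`, `CrossGenericRung`, `CrossSpecialRung`, `crossGenericRung_iff`, `crossSpecialRung_iff`,
`seqDimFour_one_iff`, `isExitPt_of_crossLeaf`, `xGenRungAt_of_engines`, `crossGenericRung_of_engines`,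
`crossSpecialRung_of_spreadSpecialRung`, `spreadGenericRung_of_crossGenericRung`.

(Sources: Hironaka1964 Ch. III; CossartJannsenSaito2020 Ch. 2, Ch. 8–9; CossartPiltant2008 Prop. 4.2;
CossartPiltant2019 Rem. 3.2; BierstoneGrigorievMilmanWlodarczyk2011 §3.1; Moh1987; Hauser2010Kangaroo; Giraud1975;
Narasimhan1983.)
-/

open CategoryTheory AlgebraicGeometry TopologicalSpace IsLocalRing
open Literature.AlgebraicGeometry.Resolution
open Summit.ResolutionOfSingularities.ResolutionOfSingularities.Theorems
open Summit.ResolutionOfSingularities.ResolutionOfSingularities.Theorems.WeakOrderReduction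
open Summit.ResolutionOfSingularities.ResolutionOfSingularities.Theorems.DeltaFaceCutClasses
open Summit.ResolutionOfSingularities.ResolutionOfSingularities.Theorems.RelativeDeltaCut
open Summit.ResolutionOfSingularities.ResolutionOfSingularities.Theorems.CurveLeafExit
open Summit.ResolutionOfSingularities.ResolutionOfSingularities.Theorems.PinchCut
open Summit.ResolutionOfSingularities.ResolutionOfSingularities.Theorems.JetCut
open Summit.ResolutionOfSingularities.ResolutionOfSingularities.Theorems.PurityCut
open Summit.ResolutionOfSingularities.ResolutionOfSingularities.Theorems.SplitCut
open Summit.ResolutionOfSingularities.ResolutionOfSingularities.Theorems.CylinderCut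
open Summit.ResolutionOfSingularities.ResolutionOfSingularities.Theorems.SpreadCut
open MvPolynomial

namespace Summit.ResolutionOfSingularities.ResolutionOfSingularities.Theorems.CrossCut

/-- Pointwise: the cross-special class IS the `crossLeaf`-special class of §G.  KERNEL (PROVED). [folklore] -/
theorem isSpecPt_crossLeaf_iff {k : Type} [Field k] {Y : Scheme.{0}} (g : Y ⟶ Spec (.of k)) (hY : Scheme.IsRegular Y)
    (I : Y.IdealSheafData) (n : ℕ) (y : Y) : Leaf.IsSpecPt crossLeaf g hY I n y ↔ IsCrossSpecialPt g hY I n y := by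
  constructor
  · rintro ⟨hL, hno⟩
    exact ⟨(isSpecPt_spreadLeaf_iff g hY I n y).mp ⟨hL, fun h => hno (Or.inl h)⟩, fun h => hno (Or.inr h)⟩
  · rintro ⟨hS, hX⟩
    obtain ⟨hL, hno⟩ := (isSpecPt_spreadLeaf_iff g hY I n y).mpr hS
    refine ⟨hL, ?_⟩
    rintro (h | h)
    · exact hno h
    · exact hX h

/-- The cross-special class is contained in g19's spread-special class (the residual SHRINKS by letter).  KERNEL
(PROVED). [folklore] -/
theorem isSpreadSpecialPt_of_isCrossSpecialPt {k : Type} [Field k] {Y : Scheme.{0}} {g : Y ⟶ Spec (.of k)}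
    {hY : Scheme.IsRegular Y} {I : Y.IdealSheafData} {n : ℕ} {y : Y} (h : IsCrossSpecialPt g hY I n y) :
    IsSpreadSpecialPt g hY I n y :=
  h.1

/-- … and hence in g18's cylinder-special class.  KERNEL (PROVED). [folklore] -/
theorem isCylSpecialPt_of_isCrossSpecialPt {k : Type} [Field k] {Y : Scheme.{0}} {g : Y ⟶ Spec (.of k)}
    {hY : Scheme.IsRegular Y} {I : Y.IdealSheafData} {n : ℕ} {y : Y} (h : IsCrossSpecialPt g hY I n y) :
    IsCylSpecialPt g hY I n y :=
  h.1.1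

/-- **EXACT POINTWISE DICHOTOMY of g19's residual class** (the structural dichotomy at a point): spread-special ⟺
(spread-special and a
cross point — the TRANSVERSAL TWO-BRANCH side, decided) ∨ cross-special.  KERNEL (PROVED). [folklore] -/
theorem isSpreadSpecialPt_iff {k : Type} [Field k] {Y : Scheme.{0}} (g : Y ⟶ Spec (.of k)) (hY : Scheme.IsRegular Y)
    (I : Y.IdealSheafData) (n : ℕ) (y : Y) :
    IsSpreadSpecialPt g hY I n y ↔
      (IsSpreadSpecialPt g hY I n y ∧ IsCrossPt I n y) ∨ IsCrossSpecialPt g hY I n y := by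
  constructor
  · intro h
    by_cases hc : IsCrossPt I n y
    · exact Or.inl ⟨h, hc⟩
    · exact Or.inr ⟨h, hc⟩
  · rintro (⟨h, _⟩ | ⟨h, _⟩) <;> exact h

/-- At markings `n ≠ 2` the cross-special class IS the spread-special class (the cross letter is a marking-`2`
letter).  KERNEL (PROVED). [folklore] -/
theorem isCrossSpecialPt_iff_of_ne_two {k : Type} [Field k] {Y : Scheme.{0}} (g : Y ⟶ Spec (.of k)) (hY : Scheme.IsRegular Y)
    (I : Y.IdealSheafData) {n : ℕ} (hn : n ≠ 2) (y : Y) :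
    IsCrossSpecialPt g hY I n y ↔ IsSpreadSpecialPt g hY I n y :=
  ⟨fun h => h.1, fun h => ⟨h, fun hc => hn (eq_two_of_isCrossPt hc)⟩⟩

namespace Cross

/-! ### §X.5  The graded statements of the CROSS cut (instances of §G with the cross leaf) -/

/-- **`SeqXGen n`** — weak order reduction in dimension four at marking `n` for data ALL of whose top points are in
the decided classes of
g19 or CROSS points.  [DECIDED-MOD-PORT: `xGenRungAt_of_engines`.]  STATEMENT SCHEMA (= `Leaf.SeqGen crossLeaf n`).
(Sources: BierstoneGrigorievMilmanWlodarczyk2011 §3.1; CossartPiltant2008 Prop. 4.2; Hironaka1967.) -/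
def SeqXGen (n : ℕ) : Prop := Leaf.SeqGen crossLeaf n

/-- **`SeqXSpec n`** — THE LOCATED CLASS: weak order reduction at marking `n` for data having a CROSS-SPECIAL core top point.
[UNDECIDED · IDEA-NEEDED.]  STATEMENT SCHEMA (= `Leaf.SeqSpec crossLeaf n`). (Sources: CossartPiltant2019 Rem. 3.2; Moh1987.) -/
def SeqXSpec (n : ℕ) : Prop := Leaf.SeqSpec crossLeaf n

/-- `XGenRungAt n` — the decided rung at one marking. -/
def XGenRungAt (n : ℕ) : Prop := SeqDimFour 2 n → SeqXGen n

/-- **`CrossGenericRung`** — the DECIDED half of `RungOne` (29273) for the cross leaf.  [WEAKER · DECIDED-MOD-PORT(M+):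
`crossGenericRung_of_ports`.]  STATEMENT (decided piece). (Sources: Hironaka1967; CossartPiltant2008 Prop. 4.2;
CossartJannsenSaito2020.) -/
def CrossGenericRung : Prop := E 2 → ∀ n : ℕ, 1 ≤ n → SeqXGen n

/-- **`CrossSpecialRung`** — THE LOCATED RESIDUAL of this node: `E 2 →` weak order reduction for every marking and
all data with a
cross-special core top point.  [WEAKER BY LETTER than `Spread.SpreadSpecialRung` · UNDECIDED · IDEA-NEEDED · cofinal ⇒ score 0.]
STATEMENT (located residual). (Sources: CossartPiltant2019 Rem. 3.2; Moh1987; Giraud1975; Narasimhan1983.) -/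
def CrossSpecialRung : Prop := E 2 → ∀ n : ℕ, 1 ≤ n → SeqXSpec n

/-- `crossGenericRung_iff`: Auxiliary step of this node's calculus, VERBATIM from the lens file (see the module
docstring); the statement is its type. [folklore] -/
theorem crossGenericRung_iff : CrossGenericRung ↔ Leaf.GenericRung crossLeaf := Iff.rfl

/-- `crossSpecialRung_iff`: Auxiliary step of this node's calculus, VERBATIM from the lens file (see the module
docstring); the statement is its type. [folklore] -/
theorem crossSpecialRung_iff : CrossSpecialRung ↔ Leaf.SpecialRung crossLeaf := Iff.rfl

section Kernels

variable {n : ℕ}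

/-! ### §X.6  Kernels of the CROSS cut (instantiated from §G; 0 sorry) -/

/-- **EXACT at each marking**: `SeqDimFour 1 n ⟺ SeqXGen n ∧ SeqXSpec n`. [folklore] -/
theorem seqDimFour_one_iff : SeqDimFour 1 n ↔ SeqXGen n ∧ SeqXSpec n :=
  Leaf.seqDimFour_one_iff (L := crossLeaf)

/-- Under the engines (M) (C) (G) (S) (Cyl) (JCyl) (Γ) (X) every point of the cross leaf is a curve-exit point or a
component-exit point.
[folklore] -/
theorem isExitPt_of_crossLeaf (hM : MonomialPinchExit) (hC : FlatConeExit) (hGE : GrandExit) (hSE : SplitConeExit)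
    (hCE : CylinderExit) (hJE : JetCylinderExit) (hΓE : SpreadExit) (hXE : CrossExit)
    (hn : 2 ≤ n) ⦃Y : Scheme.{0}⦄ (hY : Scheme.IsRegular Y) ⦃I : Y.IdealSheafData⦄ ⦃y : Y⦄ (h : crossLeaf I n y) :
    IsCurveExitPt I n y ∨ IsComponentExitPt I n y := by
  rcases h with h | h
  · exact Or.inl (Spread.isCurveExitPt_of_spreadLeaf hM hC hGE hSE hCE hJE hΓE hn hY h)
  · exact Or.inr (isComponentExitPt_of_isCrossPt hXE hY h)

/-- **THE ENGINES AT WORK**: the five tree engines, (M) (C) (G) (S) (Cyl) (JCyl) (Γ), the NEW engine (X) and the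
COMPONENT port give
`XGenRungAt n` for `n ≥ 2`. [folklore] -/
theorem xGenRungAt_of_engines (hV : VeryNearCutClasses.VeryNearExit) (hD : DeltaPackageExit)
    (hU : UniformCurvePackageExit) (hR : RelCurvePackageExit) (hN : NormalConeJumpExit)
    (hM : MonomialPinchExit) (hC : FlatConeExit) (hGE : GrandExit) (hSE : SplitConeExit)
    (hCE : CylinderExit) (hJE : JetCylinderExit) (hΓE : SpreadExit) (hXE : CrossExit) (hP : ComponentPackagePort n)
    (hn : 2 ≤ n) : XGenRungAt n :=
  Leaf.genRungAt_of_componentPort (L := crossLeaf) hV hD hU hR hN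
    (isExitPt_of_crossLeaf hM hC hGE hSE hCE hJE hΓE hXE hn) hP hn

/-- **`CrossGenericRung` is DECIDED modulo the typed pieces**: engines (as hypotheses), the component port at every
marking `≥ 2`, the
order-one contact port. [folklore] -/
theorem crossGenericRung_of_engines (hV : VeryNearCutClasses.VeryNearExit) (hD : DeltaPackageExit)
    (hU : UniformCurvePackageExit) (hR : RelCurvePackageExit) (hN : NormalConeJumpExit)
    (hM : MonomialPinchExit) (hC : FlatConeExit) (hGE : GrandExit) (hSE : SplitConeExit)
    (hCE : CylinderExit) (hJE : JetCylinderExit) (hΓE : SpreadExit) (hXE : CrossExit)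
    (hP : ∀ n : ℕ, 2 ≤ n → ComponentPackagePort n) (h1 : FaceFormCutClasses.OrderOneContact) : CrossGenericRung :=
  Leaf.genericRung_of_componentPort (L := crossLeaf) hV hD hU hR hN
    (fun _ hn => isExitPt_of_crossLeaf hM hC hGE hSE hCE hJE hΓE hXE hn) hP h1

/-! ### §X.7  EXACT RE-LOCATIONS (the residual shrinks; equivalent modulo the cross decided half) -/

/-- **REFINEMENT EDGE (hypothesis-free)**: g19's residual implies g20's — `Spread.SpreadSpecialRung →
CrossSpecialRung` (WEAKER BY LETTER).
[folklore] -/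
theorem crossSpecialRung_of_spreadSpecialRung (h : Spread.SpreadSpecialRung) : CrossSpecialRung :=
  Leaf.specialRung_mono spreadLeaf_le_crossLeaf (Spread.spreadSpecialRung_iff.mp h)

/-- The cross decided half contains g19's: `CrossGenericRung → Spread.SpreadGenericRung`. [folklore] -/
theorem spreadGenericRung_of_crossGenericRung (h : CrossGenericRung) : Spread.SpreadGenericRung :=
  Spread.spreadGenericRung_iff.mpr (Leaf.genericRung_anti spreadLeaf_le_crossLeaf h)

end Kernels

end Cross

end Summit.ResolutionOfSingularities.ResolutionOfSingularities.Theorems.CrossCut
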